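import Summits.AtomisticToContinuum.BoseEinsteinCondensation.Theses.BECCutLineWeakDisorder
import Literature.MathematicalPhysics.QuantumManyBody.SwapPurity

/-!
# Route `BECCutLineWeakDisorder` — support item `OccupationStability` (stmt-AtomisticToContinuum-9074)

Closes stmt-AtomisticToContinuum-9074 (exact signature of
`Summit.AtomisticToContinuum.BoseEinsteinCondensation.Theses.BECCutLineWeakDisorder.OccupationStability`,
shared verbatim by the sibling routes `BECClassicalWindow`, `BECRieszReverseHolder`, `BECThermalBridge`,
`BECCellInformation`, `BECHeatBathGap`): for a normalised a.e.-strongly measurable mode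
`u : ℝ³ → ℂ` (`∫ |u|² = 1`), Dirichlet trial states `Ψ, Φ ∈ TrialState (n+1) L` and a unit
complex number `c`,

  `occ(u, Ψ)^{1/2} ≤ occ(u, Φ)^{1/2} + (n+1)^{1/2} ‖Ψ - cΦ‖_{L²}`,

where `occ(u, Θ) = occupation (n+1) u Θ = (n+1) ∫ |A_Θ(Y)|² dY` with the mode pairing of the slice
`A_Θ(Y) = ∫ conj(u x) Θ(x :: Y) dx` [LSSY2005, §1.2 (1.17)].

Proof (elementary bookkeeping, as announced by the planner): pointwise in the bath configuration
`Y`, `|A_Ψ(Y)| ≤ |A_Φ(Y)| + (∫ |Ψ(x::Y) - cΦ(x::Y)|² dx)^{1/2}` by linearity of the Bochner integral,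
`|c| = 1` and Cauchy–Schwarz with `∫|u|² = 1` (`nnnorm_integral_conj_mul_le_add`; the junk value
`0` of a non-integrable pairing only helps); then Minkowski in `L²(dY)`
(`ENNReal.lintegral_Lp_add_le`) and Tonelli `∫ dY ∫ dx |D(x::Y)|² = ∫ |D|²`
(`lintegral_lintegral_sq_nnnorm_vecCons` of `SwapPurity.lean`), and finally `√(N·a) = √N·√a`.
-/

noncomputable section

namespace Summit.AtomisticToContinuum.BoseEinsteinCondensation.Theorems

open MeasureTheory
open scoped ENNReal NNReal ComplexConjugate
open Literature.MathematicalPhysics.QuantumManyBody.BoseGas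

namespace OccupationStability

/-- Cauchy–Schwarz against a normalised mode: `∫ |conj(u) w| ≤ (∫ |w|²)^{1/2}` when `∫ |u|² = 1`.
[folklore] -/
theorem lintegral_enorm_conj_mul_le {u w : Space → ℂ} (hu : AEStronglyMeasurable u volume)
    (hu1 : ∫⁻ x, (‖u x‖₊ : ℝ≥0∞) ^ 2 = 1) (hw : AEStronglyMeasurable w volume) :
    ∫⁻ x, ‖conj (u x) * w x‖ₑ ≤ (∫⁻ x, (‖w x‖₊ : ℝ≥0∞) ^ 2) ^ (1 / 2 : ℝ) := by
  calc ∫⁻ x, ‖conj (u x) * w x‖ₑ = ∫⁻ x, ‖u x‖ₑ * ‖w x‖ₑ := by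
        refine lintegral_congr fun x => ?_
        rw [enorm_mul, ← ofReal_norm (conj (u x)), Complex.norm_conj, ofReal_norm]
    _ ≤ (∫⁻ x, ‖u x‖ₑ ^ (2 : ℝ)) ^ (1 / (2 : ℝ)) * (∫⁻ x, ‖w x‖ₑ ^ (2 : ℝ)) ^ (1 / (2 : ℝ)) :=
        ENNReal.lintegral_mul_le_Lp_mul_Lq volume Real.HolderConjugate.two_two hu.enorm hw.enorm
    _ = (∫⁻ x, (‖w x‖₊ : ℝ≥0∞) ^ 2) ^ (1 / 2 : ℝ) := by
        simp only [ENNReal.rpow_two, enorm_eq_nnnorm]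
        rw [hu1, ENNReal.one_rpow, one_mul]

/-- **Pointwise stability of the mode pairing.** For a normalised mode `u`, a.e.-strongly
measurable `ψ, φ : ℝ³ → ℂ` and `|c| = 1`:
`|∫ conj(u) ψ| ≤ |∫ conj(u) φ| + (∫ |ψ - cφ|²)^{1/2}` (Bochner integrals, junk value `0` when not
integrable: if `conj(u)(ψ - cφ)` is not integrable the right-hand side is `⊤` by Cauchy–Schwarz, and
if `conj(u) φ` is not integrable while `conj(u)(ψ - cφ)` is, then neither is `conj(u) ψ`).
[folklore] -/
theorem nnnorm_integral_conj_mul_le_add {u ψ φ : Space → ℂ} (hu : AEStronglyMeasurable u volume)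
    (hu1 : ∫⁻ x, (‖u x‖₊ : ℝ≥0∞) ^ 2 = 1) (hψ : AEStronglyMeasurable ψ volume)
    (hφ : AEStronglyMeasurable φ volume) {c : ℂ} (hc : ‖c‖ = 1) :
    (‖∫ x, conj (u x) * ψ x‖₊ : ℝ≥0∞) ≤
      (‖∫ x, conj (u x) * φ x‖₊ : ℝ≥0∞) +
        (∫⁻ x, (‖ψ x - c * φ x‖₊ : ℝ≥0∞) ^ 2) ^ (1 / 2 : ℝ) := by
  have hconj : Continuous (conj : ℂ → ℂ) := Complex.continuous_conj
  have hd : AEStronglyMeasurable (fun x => ψ x - c * φ x) volume :=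
    hψ.sub (aestronglyMeasurable_const.mul hφ)
  have hud : AEStronglyMeasurable (fun x => conj (u x) * (ψ x - c * φ x)) volume :=
    (hconj.comp_aestronglyMeasurable hu).mul hd
  have hCS : ∫⁻ x, ‖conj (u x) * (ψ x - c * φ x)‖ₑ ≤
      (∫⁻ x, (‖ψ x - c * φ x‖₊ : ℝ≥0∞) ^ 2) ^ (1 / 2 : ℝ) :=
    lintegral_enorm_conj_mul_le hu hu1 hd
  by_cases htop : (∫⁻ x, (‖ψ x - c * φ x‖₊ : ℝ≥0∞) ^ 2) = ⊤
  · rw [htop, ENNReal.top_rpow_of_pos (by norm_num), add_top]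
    exact le_top
  -- the difference pairing is integrable
  have hdi : Integrable (fun x => conj (u x) * (ψ x - c * φ x)) :=
    ⟨hud, (hasFiniteIntegral_iff_enorm).2
      (lt_of_le_of_lt hCS (ENNReal.rpow_lt_top_of_nonneg (by norm_num) htop))⟩
  by_cases hφi : Integrable (fun x => conj (u x) * φ x)
  · -- linear decomposition `conj(u) ψ = c · conj(u) φ + conj(u) (ψ - cφ)`
    have hsum : (fun x => conj (u x) * ψ x) =
        fun x => c * (conj (u x) * φ x) + conj (u x) * (ψ x - c * φ x) := by
      funext x; ring
    have hint : ∫ x, conj (u x) * ψ x =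
        c * (∫ x, conj (u x) * φ x) + ∫ x, conj (u x) * (ψ x - c * φ x) := by
      rw [hsum, integral_add (hφi.const_mul c) hdi, integral_const_mul]
    calc (‖∫ x, conj (u x) * ψ x‖₊ : ℝ≥0∞)
        = ‖c * (∫ x, conj (u x) * φ x) + ∫ x, conj (u x) * (ψ x - c * φ x)‖ₑ := by
          rw [hint, enorm_eq_nnnorm]
      _ ≤ ‖c * ∫ x, conj (u x) * φ x‖ₑ + ‖∫ x, conj (u x) * (ψ x - c * φ x)‖ₑ :=
          enorm_add_le _ _
      _ = (‖∫ x, conj (u x) * φ x‖₊ : ℝ≥0∞) + ‖∫ x, conj (u x) * (ψ x - c * φ x)‖ₑ := by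
          rw [enorm_mul, ← ofReal_norm c, hc, ENNReal.ofReal_one, one_mul, enorm_eq_nnnorm]
      _ ≤ (‖∫ x, conj (u x) * φ x‖₊ : ℝ≥0∞) +
            (∫⁻ x, (‖ψ x - c * φ x‖₊ : ℝ≥0∞) ^ 2) ^ (1 / 2 : ℝ) := by
          gcongr
          exact (enorm_integral_le_lintegral_enorm _).trans hCS
  · -- then `conj(u) ψ` is not integrable either, and its Bochner integral is `0`
    have hc0 : c ≠ 0 := by
      rintro rfl
      simp at hc
    have hψi : ¬ Integrable (fun x => conj (u x) * ψ x) := by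
      intro hψi
      apply hφi
      have heq : (fun x => conj (u x) * φ x) =
          fun x => c⁻¹ * (conj (u x) * ψ x - conj (u x) * (ψ x - c * φ x)) := by
        funext x
        field_simp
        ring
      rw [heq]
      exact (hψi.sub hdi).const_mul _
    rw [integral_undef hψi, nnnorm_zero, ENNReal.coe_zero]
    exact bot_le

/-- `Y ↦ A_Θ(Y) = ∫ conj(u x) Θ(x :: Y) dx` is a.e.-strongly measurable for an a.e.-strongly
measurable mode `u` and a continuous `Θ` (Fubini measurability of a parametric Bochner integral).
[folklore] -/
theorem aestronglyMeasurable_pairing {n : ℕ} {u : Space → ℂ} (hu : AEStronglyMeasurable u volume)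
    {Θ : Config (n + 1) → ℂ} (hΘ : Continuous Θ) :
    AEStronglyMeasurable (fun Y : Config n => ∫ x, conj (u x) * Θ (Matrix.vecCons x Y)) volume := by
  have hF : AEStronglyMeasurable
      (fun p : Config n × Space => conj (u p.2) * Θ (Matrix.vecCons p.2 p.1))
      ((volume : Measure (Config n)).prod (volume : Measure Space)) :=
    (Complex.continuous_conj.comp_aestronglyMeasurable hu.comp_snd).mul
      (hΘ.comp (continuous_snd.matrixVecCons continuous_fst)).aestronglyMeasurable
  exact hF.integral_prod_right'

end OccupationStability

open OccupationStability in
/-- **`OccupationStability`** (closes stmt-AtomisticToContinuum-9074, exact route signature):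
for a normalised a.e.-strongly measurable mode `u`, trial states `Ψ, Φ ∈ TrialState (n+1) L` and
`|c| = 1`, `occ(u,Ψ)^{1/2} ≤ occ(u,Φ)^{1/2} + (n+1)^{1/2} (∫ |Ψ - cΦ|²)^{1/2}` — `√occ(u,·)` is a
seminorm dominated by `√N ‖·‖₂`: pointwise slice bound `nnnorm_integral_conj_mul_le_add`,
Minkowski in `L²(dY)` and Tonelli in `x :: Y`. [cite: LSSY2005, §1.2 (1.17)] -/
theorem occupationStability_proof :
    Summit.AtomisticToContinuum.BoseEinsteinCondensation.Theses.BECCutLineWeakDisorder.OccupationStability := by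
  intro n L u hu hu1 Ψ Φ c hc
  have hocc : ∀ Θ : Config (n + 1) → ℂ, occupation (n + 1) u Θ =
      (n + 1 : ℝ≥0∞) * ∫⁻ Y : Config n,
        (‖∫ x, conj (u x) * Θ (Matrix.vecCons x Y)‖₊ : ℝ≥0∞) ^ 2 := fun Θ => rfl
  have hN : ((n + 1 : ℕ) : ℝ≥0∞) = (n + 1 : ℝ≥0∞) := by push_cast; rfl
  have hΨc : Continuous Ψ.ψ := Ψ.contDiff.continuous
  have hΦc : Continuous Φ.ψ := Φ.contDiff.continuous
  have hDm : Measurable fun X => Ψ.ψ X - c * Φ.ψ X :=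
    (hΨc.sub (continuous_const.mul hΦc)).measurable
  -- Tonelli in `X = x :: Y`
  have hTon : ∫⁻ X, (‖Ψ.ψ X - c * Φ.ψ X‖₊ : ℝ≥0∞) ^ 2 =
      ∫⁻ Y : Config n, ∫⁻ x : Space,
        (‖Ψ.ψ (Matrix.vecCons x Y) - c * Φ.ψ (Matrix.vecCons x Y)‖₊ : ℝ≥0∞) ^ 2 :=
    (lintegral_lintegral_sq_nnnorm_vecCons hDm).symm
  -- Minkowski in `L²(dY)` on top of the pointwise slice bound
  have key : (∫⁻ Y : Config n,
        (‖∫ x, conj (u x) * Ψ.ψ (Matrix.vecCons x Y)‖₊ : ℝ≥0∞) ^ 2) ^ (1 / 2 : ℝ) ≤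
      (∫⁻ Y : Config n,
          (‖∫ x, conj (u x) * Φ.ψ (Matrix.vecCons x Y)‖₊ : ℝ≥0∞) ^ 2) ^ (1 / 2 : ℝ) +
        (∫⁻ Y : Config n, ∫⁻ x : Space,
          (‖Ψ.ψ (Matrix.vecCons x Y) - c * Φ.ψ (Matrix.vecCons x Y)‖₊ : ℝ≥0∞) ^ 2) ^
            (1 / 2 : ℝ) := by
    set f : Config n → ℝ≥0∞ := fun Y =>
      (‖∫ x, conj (u x) * Φ.ψ (Matrix.vecCons x Y)‖₊ : ℝ≥0∞) with hf
    set g : Config n → ℝ≥0∞ := fun Y => (∫⁻ x : Space,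
      (‖Ψ.ψ (Matrix.vecCons x Y) - c * Φ.ψ (Matrix.vecCons x Y)‖₊ : ℝ≥0∞) ^ 2) ^ (1 / 2 : ℝ)
      with hg
    have hfm : AEMeasurable f volume :=
      (aestronglyMeasurable_pairing hu hΦc).aemeasurable.nnnorm.coe_nnreal_ennreal
    have hgm : AEMeasurable g volume :=
      ((measurable_lintegral_sq_nnnorm_vecCons hDm).pow_const _).aemeasurable
    have hg2 : ∀ Y, g Y ^ 2 = ∫⁻ x : Space,
        (‖Ψ.ψ (Matrix.vecCons x Y) - c * Φ.ψ (Matrix.vecCons x Y)‖₊ : ℝ≥0∞) ^ 2 := fun Y => by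
      rw [hg, ← ENNReal.rpow_two, ← ENNReal.rpow_mul]
      norm_num
    have hmink := ENNReal.lintegral_Lp_add_le (μ := (volume : Measure (Config n))) hfm hgm
      (by norm_num : (1 : ℝ) ≤ 2)
    simp only [Pi.add_apply, ENNReal.rpow_two, hg2] at hmink
    refine le_trans ?_ hmink
    gcongr with Y
    exact nnnorm_integral_conj_mul_le_add hu hu1
      (hΨc.comp (continuous_id.matrixVecCons continuous_const)).aestronglyMeasurable
      (hΦc.comp (continuous_id.matrixVecCons continuous_const)).aestronglyMeasurable hc
  rw [hocc, hocc, hN, hTon, ENNReal.mul_rpow_of_nonneg _ _ (by norm_num : (0 : ℝ) ≤ 1 / 2),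
    ENNReal.mul_rpow_of_nonneg _ _ (by norm_num : (0 : ℝ) ≤ 1 / 2), ← mul_add]
  exact mul_le_mul_right key _

end Summit.AtomisticToContinuum.BoseEinsteinCondensation.Theorems
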